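import Literature.Computation.Certificates.SemidefiniteRigorousBoundsEigenCount

/-!
# Jansson's rigorous SDP bounds with eigenvalue COUNTS in block form: the upper bound from an INDEFINITE approximate primal point (Jansson 2006, Theorems 2 and 3)

Topic `Literature/Computation/Certificates`; companion of `SemidefiniteRigorousBounds.lean` (Jansson–Chaykin–
Keil, exact data: Lemma 3.1 / Thm 3.2 / Cor 3.1 / Thm 4.1, `lmiForm_bound`), `…EigenCount.lean` (Jansson 2007
Cor. 6.1: the lower bound with the NUMBER `l` of negative eigenvalues of the dual slack, SINGLE block; Props.
8.1/8.2) and `…Enclosure.lean` (enclosure / family / box forms; Jansson 2007 Cor. 6.2 = the upper bound from a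
POSITIVE SEMIDEFINITE approximate primal point, SINGLE block).  This file types §3 of

* C. Jansson, *Rigorous Results in Combinatorial Optimization*, Dagstuhl Seminar Proceedings 05391 (IBFI Schloss
  Dagstuhl, 2006), paper 446 [Jansson2006Dagstuhl] — held text `paper:url-9569c35f2742`, 8 pp., read on the page
  2026-08-26 (problem (1)–(3) p. 2; Theorem 2 with (4)–(8) p. 6; Theorem 3 with (9)–(12) pp. 6–7; the remark on
  `ϱ_j` p. 7),

for the primal semidefinite program in block-diagonal form (their (1))
`f*_p := min Σ_{j=1}^n ⟨C_j, X_j⟩ s.t. Σ_{j=1}^n ⟨A_ij, X_j⟩ = b_i (i = 1..m), X_j ⪰ 0 (j = 1..n)`,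
`C_j, A_ij, X_j ∈ S^{s_j}`, `⟨·,·⟩ =` trace of the product, with Lagrangian dual (their (2))
`f*_d := max bᵀy s.t. Σ_{i=1}^m y_i A_ij ⪯ C_j (j = 1..n)` (`f*_d := −∞` if dual infeasible).  Verbatim:

> **Theorem 2.** Let `X̃_j ∈ S^{s_j}` for `j = 1, …, n`, and assume that each `X̃_j` has at most `k_j` negative
> eigenvalues. Suppose that the following dual boundedness qualifications hold valid:
> (i) Either the dual semidefinite problem is infeasible,
> (ii) or `f*_d` is finite, and there are simple nonnegative bounds `ȳ ∈ (ℝ₊)^m`, such that for every `ε > 0`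
> there exists a dual feasible solution `y(ε)` satisfying `−ȳ ≤ y(ε) ≤ ȳ`, and `f*_d − bᵀy(ε) ≤ ε`.  (4)
> Let `r_i = b_i − Σ_{j=1}^n ⟨A_ij, X̃_j⟩` for `i = 1, …, m`,  (5)
> `λ_j ≤ λ_min(X̃_j)` for `j = 1, …, n`, and  (6)
> `ϱ_j ≥ sup { λ_max(C_j − Σ_{i=1}^m y_i A_ij) : −ȳ ≤ y ≤ ȳ, C_j − Σ_{i=1}^m y_i A_ij ⪰ 0 }`  (7)
> for `j = 1, …, n`. Then
> `f*_d ≤ Σ_{j=1}^n ⟨C_j, X̃_j⟩ − Σ_{j=1}^n k_j λ_j⁻ ϱ_j + Σ_{i=1}^m |r_i| ȳ_i =: f̄*_d`,  (8)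
> where `λ_j⁻ := min(0, λ_j)`.
>
> **Theorem 3.** Let `ỹ ∈ ℝ^m` and assume that the following primal boundedness qualifications hold valid:
> (i) Either the primal semidefinite problem is infeasible,
> (ii) or `f*_p` is finite, and there are simple bounds `x̄ ∈ (ℝ₊)^n` such that for every `ε > 0` there exists a
> primal feasible solution `(X_j(ε))` satisfying `λ_max(X_j(ε)) ≤ x̄_j` for `j = 1, …, n`, (9) and
> `Σ_{j=1}^n ⟨C_j, X_j(ε)⟩ − f*_p ≤ ε`. (10)
> Let `D_j = C_j − Σ_{i=1}^m ỹ_i A_ij`, and `d_j ≤ λ_min(D_j)` for `j = 1, …, n`. (11)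
> Assume that `D_j` has at most `l_j` negative eigenvalues. Then
> `f*_p ≥ bᵀỹ + Σ_{j=1}^n l_j d_j⁻ x̄_j =: f̲*_p`. (12)
>
> […] Perron-Frobenius theory can be used for computing an upper bound of `ϱ_j`. It follows that an
> appropriate upper bound is `ϱ_j = ϱ(|C_j| + Σ_{i=1}^m ȳ_i |A_ij|)`, where `ϱ` denotes the spectral radius,
> which can be rigorously estimated by some norm.

## What is proved (everything; no definitions, no named facts, no instances)

Namespace `Literature.Computation.Certificates.Jansson2006`.  Hypothesis shapes as in the companion files:
`X̃_j` symmetric is `(Xt j).IsHermitian` (real matrices), "`λ_j ≤ λ_min(X̃_j)`" is `∀ i, lam j ≤ eigenvalues i`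
(or the shifted-PSD shape `X̃_j − λ_j·1 ⪰ 0` in the primed variant), "at most `k_j` negative eigenvalues" is
`#{i | eigenvalues i < 0} ≤ k j` (Mathlib's spectrum with multiplicity), "`λ_max(M) ≤ ϱ`" is `ϱ·1 − M ⪰ 0`,
`−ȳ ≤ y ≤ ȳ` is `∀ i, |y i| ≤ ybar i`.

* `dual_objective_eq` — the bookkeeping identity of the proof:
  `bᵀy = Σ_i y_i r_i + Σ_j ⟨C_j, X̃_j⟩ − Σ_j ⟨C_j − Σ_i y_i A_ij, X̃_j⟩` for ANY `y` and ANY `X̃`;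
* `theorem_2_pointwise` (and `theorem_2_pointwise'`, shifted-PSD shape for (6)) — the content of **Thm 2**:
  every dual feasible `y` with `|y| ≤ ȳ` and `λ_max(C_j − Σ_i y_i A_ij) ≤ ϱ_j` has `bᵀy ≤ f̄*_d`; the ENGINE is
  `Jansson2007.trace_mul_ge_of_negEigenvalues_le` (the proof of [Jansson2007] Cor. 6.1) with the roles of the
  dual slack `D` and the primal matrix `X` EXCHANGED: here `X̃_j` carries the eigenvalue data and
  `D_j(y) = C_j − Σ_i y_i A_ij` is the matrix with `0 ⪯ D_j(y) ⪯ ϱ_j·1`;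
* `theorem_2` — **Thm 2** under the dual boundedness qualification (ii), with (7) stated as printed (a bound
  valid for every `y` in the box whose `j`-th slack is PSD); alternative (i) means `f*_d = −∞` (p. 2) and has
  no content for a real number;
* `theorem_2_pointwise_of_posSemidef` / `theorem_2_of_posSemidef` — the case `X̃_j ⪰ 0` (`k_j = 0`): BLOCK form
  of [Jansson2007] Cor. 6.2 (a) (in the tree for one block as `Jansson2007.corollary_6_2_pointwise/corollary_6_2a`),
  no eigenvalue data and no `ϱ` needed;
* `theorem_3_feasible` / `theorem_3` — **Thm 3** in BLOCK form (`l_j`, `d_j`, `x̄_j` per block); for one block this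
  is `Jansson2007.corollary_6_1a_feasible / corollary_6_1a`, and with `l_j = s_j` it is
  `JanssonChaykinKeil.theorem_3_2` (with `B =` all blocks);
* the remark on `ϱ_j` (how a certificate reader DISCHARGES (7): `λ_max ≤` an entrywise-majorant /
  Perron–Frobenius bound or the `∞`-norm of `|C_j| + Σ_i ȳ_i |A_ij|`) is typed in the companion file
  `SemidefiniteRigorousBoundsSlackLambdaMax.lean` (`Jansson2006.rho_of_majorant`, `rho_of_abs_rowSum_le`),
  whose conclusions have exactly the shape of the hypothesis `hrho` of `theorem_2` below.

Deliberately NOT here: Theorem 1 of the source (p. 5, the Equicut relaxation `f*_p ≥ Σ_{i≤n} ỹ_i + l·n·d⁻`) —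
it is `Jansson2007.corollary_6_1a_feasible` instantiated with `C = L/4`, `A_i = e_ie_iᵀ (i ≤ n)`,
`A_{n+1} = eeᵀ`, `b = (e, 0)`, `x̄ = n` (an application, not a certificate kind); interval input data (p. 7,
"canonical" corollaries by inclusion isotonicity) — the enclosure forms of `…Enclosure.lean` show the pattern;
how `k_j`, `λ_j` are CERTIFIED for a floating-point `X̃_j` (inertia of an exact `LDLᵀ`, resp. a verified
shifted Cholesky factorisation — `Literature/Analysis/InnerProduct/CholeskyResidualEigenvalueBounds.lean`,
`Literature/Analysis/ValidatedNumerics/InertiaSpectrumSlicing.lean`): they are hypotheses here.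

## References

* [Jansson2006Dagstuhl] C. Jansson, *Rigorous Results in Combinatorial Optimization*, Dagstuhl Seminar Proceedings
  05391, paper 446 (2006), §3 Theorems 2–3, pp. 6–7.
* [Jansson2007] C. Jansson, *Guaranteed accuracy for conic programming problems in vector lattices*,
  arXiv:0707.4366 (2007), Thm 4.2 / Cor. 6.1 / Cor. 6.2 — the single-block PSD cases, in the tree.
* [JanssonChaykinKeil2008] C. Jansson, D. Chaykin, C. Keil, SIAM J. Numer. Anal. 46 (2007/08) 180–200 — the
  `l_j = s_j` lower bound (Thm 3.2) and the eigenvalue-free upper bound (Thm 4.1), in the tree.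
-/

namespace Literature.Computation.Certificates.Jansson2006

open Matrix Finset
open scoped BigOperators

/-! ### Theorem 2: the upper bound from an indefinite approximate primal point -/

section Theorem2

variable {ι : Type*} [Fintype ι] {σ : ι → Type*} [∀ j, Fintype (σ j)] [∀ j, DecidableEq (σ j)]
  {μ : Type*} [Fintype μ]

omit [∀ j, DecidableEq (σ j)] in
/-- The bookkeeping identity of the proof of Theorem 2: for ANY `y ∈ ℝ^m` and ANY matrices `X̃_j`,
`bᵀy = Σ_i y_i r_i + Σ_j ⟨C_j, X̃_j⟩ − Σ_j ⟨C_j − Σ_i y_i A_ij, X̃_j⟩` with `r_i = b_i − Σ_j ⟨A_ij, X̃_j⟩`.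
[cite: Jansson2006Dagstuhl, Thm 2 (proof structure; cf. [8] there) and (5), p. 6] -/
theorem dual_objective_eq (C : ∀ j, Matrix (σ j) (σ j) ℝ) (A : μ → ∀ j, Matrix (σ j) (σ j) ℝ) (b : μ → ℝ)
    (Xt : ∀ j, Matrix (σ j) (σ j) ℝ) (y : μ → ℝ) :
    ∑ i, b i * y i = ∑ i, y i * (b i - ∑ j, trace (A i j * Xt j)) + ∑ j, trace (C j * Xt j)
      - ∑ j, trace ((C j - ∑ i, y i • A i j) * Xt j) := by
  have h1 : ∀ j, trace ((C j - ∑ i, y i • A i j) * Xt j) =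
      trace (C j * Xt j) - ∑ i, y i * trace (A i j * Xt j) := by
    intro j
    rw [sub_mul, Matrix.trace_sub, Finset.sum_mul, Matrix.trace_sum]
    simp only [Matrix.smul_mul, Matrix.trace_smul, smul_eq_mul]
  have h2 : ∑ j, trace ((C j - ∑ i, y i • A i j) * Xt j) =
      ∑ j, trace (C j * Xt j) - ∑ i, y i * ∑ j, trace (A i j * Xt j) := by
    rw [Finset.sum_congr rfl fun j _ => h1 j, Finset.sum_sub_distrib, Finset.sum_comm]
    congr 1
    exact Finset.sum_congr rfl fun i _ => by rw [Finset.mul_sum]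
  have h3 : ∑ i, y i * (b i - ∑ j, trace (A i j * Xt j)) =
      ∑ i, y i * b i - ∑ i, y i * ∑ j, trace (A i j * Xt j) := by
    rw [← Finset.sum_sub_distrib]
    exact Finset.sum_congr rfl fun i _ => by ring
  have hb : ∑ i, b i * y i = ∑ i, y i * b i := Finset.sum_congr rfl fun i _ => mul_comm _ _
  rw [h2, h3, hb]
  ring

omit [∀ j, DecidableEq (σ j)] in
/-- `Σ_i y_i r_i ≤ Σ_i |r_i| ȳ_i` for `|y| ≤ ȳ` (plumbing). [cite: Jansson2006Dagstuhl, Thm 2, (8), p. 6] -/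
private theorem sum_mul_le_sum_abs_mul {y ybar r : μ → ℝ} (hyb : ∀ i, |y i| ≤ ybar i) :
    ∑ i, y i * r i ≤ ∑ i, |r i| * ybar i := by
  refine Finset.sum_le_sum fun i _ => ?_
  have h1 : y i * r i ≤ |y i| * |r i| := by rw [← abs_mul]; exact le_abs_self _
  have h2 : |y i| * |r i| ≤ ybar i * |r i| := mul_le_mul_of_nonneg_right (hyb i) (abs_nonneg _)
  linarith [mul_comm (ybar i) (|r i|)]

/-- theorem (**Jansson 2006, Theorem 2 — the pointwise content**). Block SDP (1) with dual (2). Let `X̃_j` be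
symmetric (`hXt`) with `λ_j ≤ λ_min(X̃_j)` (`hlam`, (6)) and at most `k_j` negative eigenvalues (`hk`), residuals
`r_i = b_i − Σ_j ⟨A_ij, X̃_j⟩` (`hr`, (5)), and `ϱ_j ≥ 0` (`hrho0`). Then EVERY dual feasible `y`
(`hy : C_j − Σ_i y_i A_ij ⪰ 0`) with `|y_i| ≤ ȳ_i` (`hyb`) and `λ_max(C_j − Σ_i y_i A_ij) ≤ ϱ_j` (`hyrho`, what
(7) provides) satisfies `bᵀy ≤ Σ_j ⟨C_j, X̃_j⟩ − Σ_j k_j λ_j⁻ ϱ_j + Σ_i |r_i| ȳ_i`, `λ_j⁻ = min(0, λ_j)`.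
Proof: `bᵀy = Σ y_i r_i + Σ ⟨C_j, X̃_j⟩ − Σ ⟨D_j(y), X̃_j⟩` (`dual_objective_eq`), `Σ y_i r_i ≤ Σ |r_i| ȳ_i`,
and per block `⟨D_j(y), X̃_j⟩ ≥ k_j λ_j⁻ ϱ_j` by the eigen-count engine `Jansson2007.trace_mul_ge_of_neg
Eigenvalues_le` with the roles of `D` and `X` exchanged (`0 ⪯ D_j(y) ⪯ ϱ_j·1`, `X̃_j` indefinite).
SOURCE: [cite: Jansson2006Dagstuhl, Thm 2, (5)–(8), p. 6] — read on the page 2026-08-26; DEVIATIONS from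
print: the conclusion is the inequality for each bounded dual feasible `y` from which (8) follows under DBQ
(`theorem_2`); `ϱ_j ≥ 0` is explicit here (in print it follows from (7) whenever the box contains a dual
feasible point, the blocks being nonempty).  CERTIFICATE KIND: primal-residual UPPER certificate from an
INDEFINITE approximate primal (`X̃`, eigen-data `k_j`, `λ_j`, residuals `r`, box `ȳ`, `ϱ_j`);
FIELDS: `Xt ↦ X̃`, `k ↦ k_j`, `lam ↦ λ_j`, `r ↦ r_i`, `ybar ↦ ȳ`, `rho ↦ ϱ_j`.
NOT COVERED: how `k_j` (inertia of an exact `LDLᵀ`) and `λ_j` (verified shifted Cholesky) are certified for a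
floating-point `X̃_j`; where `ȳ` comes from; the interval evaluation of `r_i`; the float producer of `X̃`. -/
theorem theorem_2_pointwise (C : ∀ j, Matrix (σ j) (σ j) ℝ) (A : μ → ∀ j, Matrix (σ j) (σ j) ℝ) (b : μ → ℝ)
    {Xt : ∀ j, Matrix (σ j) (σ j) ℝ} (hXt : ∀ j, (Xt j).IsHermitian) (lam : ι → ℝ) (k : ι → ℕ)
    (hlam : ∀ j i, lam j ≤ (hXt j).eigenvalues i)
    (hk : ∀ j, (univ.filter fun i => (hXt j).eigenvalues i < 0).card ≤ k j)
    (r : μ → ℝ) (hr : ∀ i, r i = b i - ∑ j, trace (A i j * Xt j))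
    (ybar : μ → ℝ) (rho : ι → ℝ) (hrho0 : ∀ j, 0 ≤ rho j)
    {y : μ → ℝ} (hy : ∀ j, (C j - ∑ i, y i • A i j).PosSemidef) (hyb : ∀ i, |y i| ≤ ybar i)
    (hyrho : ∀ j, (rho j • (1 : Matrix (σ j) (σ j) ℝ) - (C j - ∑ i, y i • A i j)).PosSemidef) :
    ∑ i, b i * y i ≤
      ∑ j, trace (C j * Xt j) - ∑ j, (k j : ℝ) * min 0 (lam j) * rho j + ∑ i, |r i| * ybar i := by
  have hblock : ∀ j, (k j : ℝ) * min 0 (lam j) * rho j ≤ trace ((C j - ∑ i, y i • A i j) * Xt j) := by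
    intro j
    rw [Matrix.trace_mul_comm]
    exact Jansson2007.trace_mul_ge_of_negEigenvalues_le (hXt j)
      (fun i => (min_le_right _ _).trans (hlam j i)) (min_le_left _ _) (hk j) (hy j) (hyrho j) (hrho0 j)
  have hres : ∑ i, y i * r i ≤ ∑ i, |r i| * ybar i := sum_mul_le_sum_abs_mul hyb
  have hobj := dual_objective_eq C A b Xt y
  simp only [← hr] at hobj
  have hsum := Finset.sum_le_sum fun j (_ : j ∈ Finset.univ) => hblock j
  linarith

/-- theorem (Theorem 2, pointwise, with (6) in the shifted-PSD shape `X̃_j − λ_j·1 ⪰ 0` — the output shape of a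
verified Cholesky enclosure of `λ_min(X̃_j)`). Same statement as `theorem_2_pointwise`.
SOURCE: [cite: Jansson2006Dagstuhl, Thm 2, (5)–(8), p. 6] — read on the page 2026-08-26; DEVIATIONS from
print: as in `theorem_2_pointwise`; (6) entered as `X̃_j − λ_j·1 ⪰ 0` (equivalent for symmetric `X̃_j`).
CERTIFICATE KIND / FIELDS: as in `theorem_2_pointwise`.  NOT COVERED: as there. -/
theorem theorem_2_pointwise' (C : ∀ j, Matrix (σ j) (σ j) ℝ) (A : μ → ∀ j, Matrix (σ j) (σ j) ℝ) (b : μ → ℝ)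
    {Xt : ∀ j, Matrix (σ j) (σ j) ℝ} (hXt : ∀ j, (Xt j).IsHermitian) (lam : ι → ℝ) (k : ι → ℕ)
    (hlam : ∀ j, (Xt j - lam j • (1 : Matrix (σ j) (σ j) ℝ)).PosSemidef)
    (hk : ∀ j, (univ.filter fun i => (hXt j).eigenvalues i < 0).card ≤ k j)
    (r : μ → ℝ) (hr : ∀ i, r i = b i - ∑ j, trace (A i j * Xt j))
    (ybar : μ → ℝ) (rho : ι → ℝ) (hrho0 : ∀ j, 0 ≤ rho j)
    {y : μ → ℝ} (hy : ∀ j, (C j - ∑ i, y i • A i j).PosSemidef) (hyb : ∀ i, |y i| ≤ ybar i)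
    (hyrho : ∀ j, (rho j • (1 : Matrix (σ j) (σ j) ℝ) - (C j - ∑ i, y i • A i j)).PosSemidef) :
    ∑ i, b i * y i ≤
      ∑ j, trace (C j * Xt j) - ∑ j, (k j : ℝ) * min 0 (lam j) * rho j + ∑ i, |r i| * ybar i :=
  theorem_2_pointwise C A b hXt lam k
    (fun j i => Jansson2007.eigenvalues_ge_of_posSemidef_sub_smul (hXt j) (hlam j) i) hk r hr ybar rho
    hrho0 hy hyb hyrho

/-- theorem (**Jansson 2006, Theorem 2**). Block SDP (1) with dual (2). Let `X̃_j` be symmetric with at most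
`k_j` negative eigenvalues and `λ_j ≤ λ_min(X̃_j)` (6), `r_i = b_i − Σ_j ⟨A_ij, X̃_j⟩` (5), and let `ϱ_j ≥ 0`
satisfy (7): `λ_max(C_j − Σ_i y_i A_ij) ≤ ϱ_j` for every `y` with `−ȳ ≤ y ≤ ȳ` and `C_j − Σ_i y_i A_ij ⪰ 0`
(`hrho`). Assume the dual boundedness qualification (ii): the dual optimal value `f*_d` is finite and for
every `ε > 0` some dual feasible `y(ε)` has `−ȳ ≤ y(ε) ≤ ȳ` and `f*_d − bᵀy(ε) ≤ ε` (`hDBQ`; `f*_d` enters as a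
real number `fd` with this property — the printed supremum has it by (4)). Then
`f*_d ≤ Σ_j ⟨C_j, X̃_j⟩ − Σ_j k_j λ_j⁻ ϱ_j + Σ_i |r_i| ȳ_i =: f̄*_d` (8), `λ_j⁻ := min(0, λ_j)`.
(Alternative (i), dual infeasible, means `f*_d = −∞` (p. 2) and has no content for a real `fd`.)
SOURCE: [cite: Jansson2006Dagstuhl, Thm 2, (4)–(8), p. 6] — read on the page 2026-08-26; DEVIATIONS from
print: `f*_d` as a real with the DBQ (ii) property rather than an extended-real supremum; `ϱ_j ≥ 0` explicit
(implied in print by (7) and DBQ (ii) for nonempty blocks); `ȳ ≥ 0` is not assumed (implied by `|y(ε)| ≤ ȳ`).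
CERTIFICATE KIND: primal-residual UPPER certificate from an INDEFINITE approximate primal;
FIELDS: `Xt ↦ X̃`, `k ↦ k_j`, `lam ↦ λ_j`, `r ↦ r_i`, `ybar ↦ ȳ`, `rho ↦ ϱ_j`, `fd ↦ f*_d`.
NOT COVERED: verifying DBQ and the origin of `ȳ`; certifying `k_j`, `λ_j`, `ϱ_j` (for `ϱ_j` see
`rho_of_majorant` / `rho_of_abs_rowSum_le`); the interval evaluation of `r_i` and of the bound (8). -/
theorem theorem_2 (C : ∀ j, Matrix (σ j) (σ j) ℝ) (A : μ → ∀ j, Matrix (σ j) (σ j) ℝ) (b : μ → ℝ)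
    {Xt : ∀ j, Matrix (σ j) (σ j) ℝ} (hXt : ∀ j, (Xt j).IsHermitian) (lam : ι → ℝ) (k : ι → ℕ)
    (hlam : ∀ j i, lam j ≤ (hXt j).eigenvalues i)
    (hk : ∀ j, (univ.filter fun i => (hXt j).eigenvalues i < 0).card ≤ k j)
    (r : μ → ℝ) (hr : ∀ i, r i = b i - ∑ j, trace (A i j * Xt j))
    (ybar : μ → ℝ) (rho : ι → ℝ) (hrho0 : ∀ j, 0 ≤ rho j)
    (hrho : ∀ j (y : μ → ℝ), (∀ i, |y i| ≤ ybar i) → (C j - ∑ i, y i • A i j).PosSemidef →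
      (rho j • (1 : Matrix (σ j) (σ j) ℝ) - (C j - ∑ i, y i • A i j)).PosSemidef)
    (fd : ℝ)
    (hDBQ : ∀ ε > 0, ∃ y : μ → ℝ, (∀ j, (C j - ∑ i, y i • A i j).PosSemidef) ∧
      (∀ i, |y i| ≤ ybar i) ∧ fd - ε ≤ ∑ i, b i * y i) :
    fd ≤ ∑ j, trace (C j * Xt j) - ∑ j, (k j : ℝ) * min 0 (lam j) * rho j + ∑ i, |r i| * ybar i := by
  refine le_of_forall_pos_le_add fun ε hε => ?_
  obtain ⟨y, hy, hyb, hfd⟩ := hDBQ ε hε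
  have h := theorem_2_pointwise C A b hXt lam k hlam hk r hr ybar rho hrho0 hy hyb
    (fun j => hrho j y hyb (hy j))
  linarith

omit [∀ j, DecidableEq (σ j)] in
/-- theorem (Theorem 2 for a POSITIVE SEMIDEFINITE `X̃`, pointwise: `k_j = 0`). If every `X̃_j ⪰ 0` then no
eigenvalue data and no `ϱ_j` are needed: every dual feasible `y` with `|y_i| ≤ ȳ_i` has
`bᵀy ≤ Σ_j ⟨C_j, X̃_j⟩ + Σ_i |r_i| ȳ_i`, `r_i = b_i − Σ_j ⟨A_ij, X̃_j⟩`. This is the BLOCK form of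
[Jansson2007] Cor. 6.2 (a) (one block: `Jansson2007.corollary_6_2_pointwise`); `⟨D_j(y), X̃_j⟩ ≥ 0` as an
inner product of PSD matrices replaces the eigen-count engine.
SOURCE: [cite: Jansson2006Dagstuhl, Thm 2 with `k_j = 0`, (5), (8), p. 6] — read on the page 2026-08-26;
DEVIATIONS from print: specialisation `k_j = 0` (`X̃_j ⪰ 0`), whence (6)–(7) drop out; pointwise in `y`.
CERTIFICATE KIND: primal-residual UPPER certificate from a PSD approximate primal (block form);
FIELDS: `Xt ↦ X̃`, `r ↦ r_i`, `ybar ↦ ȳ`.  NOT COVERED: certifying `X̃_j ⪰ 0`; origin of `ȳ`; interval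
evaluation of `r_i`. -/
theorem theorem_2_pointwise_of_posSemidef (C : ∀ j, Matrix (σ j) (σ j) ℝ)
    (A : μ → ∀ j, Matrix (σ j) (σ j) ℝ) (b : μ → ℝ) {Xt : ∀ j, Matrix (σ j) (σ j) ℝ}
    (hXt : ∀ j, (Xt j).PosSemidef) (r : μ → ℝ) (hr : ∀ i, r i = b i - ∑ j, trace (A i j * Xt j))
    (ybar : μ → ℝ) {y : μ → ℝ} (hy : ∀ j, (C j - ∑ i, y i • A i j).PosSemidef)
    (hyb : ∀ i, |y i| ≤ ybar i) :
    ∑ i, b i * y i ≤ ∑ j, trace (C j * Xt j) + ∑ i, |r i| * ybar i := by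
  have hblock : ∀ j, 0 ≤ trace ((C j - ∑ i, y i • A i j) * Xt j) := fun j =>
    trace_mul_nonneg_of_posSemidef (hy j) (hXt j)
  have hres : ∑ i, y i * r i ≤ ∑ i, |r i| * ybar i := sum_mul_le_sum_abs_mul hyb
  have hobj := dual_objective_eq C A b Xt y
  simp only [← hr] at hobj
  have hsum := Finset.sum_nonneg fun j (_ : j ∈ Finset.univ) => hblock j
  linarith

omit [∀ j, DecidableEq (σ j)] in
/-- theorem (Theorem 2 for a POSITIVE SEMIDEFINITE `X̃` under the dual boundedness qualification (ii)): with
`X̃_j ⪰ 0`, `r_i = b_i − Σ_j ⟨A_ij, X̃_j⟩` and DBQ (ii) as in `theorem_2`, `f*_d ≤ Σ_j ⟨C_j, X̃_j⟩ + Σ_i |r_i| ȳ_i`.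
BLOCK form of [Jansson2007] Cor. 6.2 (a) (one block: `Jansson2007.corollary_6_2a`).
SOURCE: [cite: Jansson2006Dagstuhl, Thm 2 with `k_j = 0`, (4), (5), (8), p. 6] — read on the page 2026-08-26;
DEVIATIONS from print: specialisation `k_j = 0`; `f*_d` as a real with the DBQ (ii) property.
CERTIFICATE KIND: primal-residual UPPER certificate from a PSD approximate primal (block form);
FIELDS: `Xt ↦ X̃`, `r ↦ r_i`, `ybar ↦ ȳ`, `fd ↦ f*_d`.  NOT COVERED: verifying DBQ; certifying `X̃_j ⪰ 0`. -/
theorem theorem_2_of_posSemidef (C : ∀ j, Matrix (σ j) (σ j) ℝ) (A : μ → ∀ j, Matrix (σ j) (σ j) ℝ)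
    (b : μ → ℝ) {Xt : ∀ j, Matrix (σ j) (σ j) ℝ} (hXt : ∀ j, (Xt j).PosSemidef) (r : μ → ℝ)
    (hr : ∀ i, r i = b i - ∑ j, trace (A i j * Xt j)) (ybar : μ → ℝ) (fd : ℝ)
    (hDBQ : ∀ ε > 0, ∃ y : μ → ℝ, (∀ j, (C j - ∑ i, y i • A i j).PosSemidef) ∧
      (∀ i, |y i| ≤ ybar i) ∧ fd - ε ≤ ∑ i, b i * y i) :
    fd ≤ ∑ j, trace (C j * Xt j) + ∑ i, |r i| * ybar i := by
  refine le_of_forall_pos_le_add fun ε hε => ?_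
  obtain ⟨y, hy, hyb, hfd⟩ := hDBQ ε hε
  have h := theorem_2_pointwise_of_posSemidef C A b hXt r hr ybar hy hyb
  linarith

end Theorem2

/-! ### Theorem 3: the lower bound with the negative-eigenvalue count, block form -/

section Theorem3

variable {ι : Type*} [Fintype ι] {σ : ι → Type*} [∀ j, Fintype (σ j)] [∀ j, DecidableEq (σ j)]
  {μ : Type*} [Fintype μ]

/-- theorem (**Jansson 2006, Theorem 3 — the pointwise content**, block form). Let `ỹ ∈ ℝ^m`,
`D_j = C_j − Σ_i ỹ_i A_ij` symmetric (`hD`) with `d_j ≤ λ_min(D_j)` (`hd`, (11)) and at most `l_j` negative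
eigenvalues (`hl`), and `x̄_j ≥ 0` (`hxbar`). Then EVERY primal feasible `X` (`X_j ⪰ 0`,
`Σ_j ⟨A_ij, X_j⟩ = b_i`) with `λ_max(X_j) ≤ x̄_j` (`hXub : x̄_j·1 − X_j ⪰ 0`, (9)) satisfies
`Σ_j ⟨C_j, X_j⟩ ≥ bᵀỹ + Σ_j l_j d_j⁻ x̄_j`, `d_j⁻ = min(0, d_j)`.  Per block this is the engine
`Jansson2007.trace_mul_ge_of_negEigenvalues_le` of [Jansson2007] Cor. 6.1; for one block the statement is
`Jansson2007.corollary_6_1a_feasible`, with `l_j = s_j` it is `JanssonChaykinKeil.theorem_3_2` (all blocks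
bounded).
SOURCE: [cite: Jansson2006Dagstuhl, Thm 3, (9), (11)–(12), pp. 6–7] — read on the page 2026-08-26;
DEVIATIONS from print: pointwise in `X` (the PBQ version is `theorem_3`).  CERTIFICATE KIND: dual-residual
LOWER certificate with eigenvalue counts (block form); FIELDS: `y ↦ ỹ`, `d ↦ d_j`, `l ↦ l_j`, `xbar ↦ x̄_j`.
NOT COVERED: certifying `d_j`, `l_j` for a floating-point `ỹ`; the origin of `x̄`. -/
theorem theorem_3_feasible (C : ∀ j, Matrix (σ j) (σ j) ℝ) (A : μ → ∀ j, Matrix (σ j) (σ j) ℝ) (b : μ → ℝ)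
    (y : μ → ℝ) (d : ι → ℝ) (l : ι → ℕ) (hD : ∀ j, (C j - ∑ i, y i • A i j).IsHermitian)
    (hd : ∀ j i, d j ≤ (hD j).eigenvalues i)
    (hl : ∀ j, (univ.filter fun i => (hD j).eigenvalues i < 0).card ≤ l j)
    (xbar : ι → ℝ) (hxbar : ∀ j, 0 ≤ xbar j)
    {X : ∀ j, Matrix (σ j) (σ j) ℝ} (hX : ∀ j, (X j).PosSemidef)
    (hXub : ∀ j, (xbar j • (1 : Matrix (σ j) (σ j) ℝ) - X j).PosSemidef)
    (hAX : ∀ i, ∑ j, trace (A i j * X j) = b i) :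
    ∑ i, b i * y i + ∑ j, (l j : ℝ) * min 0 (d j) * xbar j ≤ ∑ j, trace (C j * X j) := by
  rw [JanssonChaykinKeil.objective_eq_defect_add C A b y hAX]
  have hb : ∑ i, b i * y i = ∑ i, y i * b i := Finset.sum_congr rfl fun i _ => mul_comm _ _
  have hblock : ∀ j, (l j : ℝ) * min 0 (d j) * xbar j ≤ trace ((C j - ∑ i, y i • A i j) * X j) :=
    fun j => Jansson2007.trace_mul_ge_of_negEigenvalues_le (hD j)
      (fun i => (min_le_right _ _).trans (hd j i)) (min_le_left _ _) (hl j) (hX j) (hXub j) (hxbar j)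
  have hsum := Finset.sum_le_sum fun j (_ : j ∈ Finset.univ) => hblock j
  linarith

/-- theorem (**Jansson 2006, Theorem 3**, block form). Under the primal boundedness qualification (ii) — `f*_p`
finite and for every `ε > 0` a primal feasible `X(ε)` with `λ_max(X_j(ε)) ≤ x̄_j` for all `j` (9) and
`Σ_j ⟨C_j, X_j(ε)⟩ − f*_p ≤ ε` (10) (`hPBQ`; `f*_p` enters as a real `fp` with this property) — and with `ỹ`,
`d_j ≤ λ_min(D_j)`, `l_j` as in `theorem_3_feasible`: `f*_p ≥ bᵀỹ + Σ_j l_j d_j⁻ x̄_j =: f̲*_p` (12).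
(Alternative (i), primal infeasible, means `f*_p = +∞` (p. 2) and has no content for a real `fp`.)
SOURCE: [cite: Jansson2006Dagstuhl, Thm 3, (9)–(12), pp. 6–7] — read on the page 2026-08-26; DEVIATIONS
from print: `f*_p` as a real with the PBQ (ii) property rather than an extended-real infimum; `x̄ ≥ 0`
explicit as printed (`x̄ ∈ (ℝ₊)^n`).  CERTIFICATE KIND: dual-residual LOWER certificate with eigenvalue counts
(block form); FIELDS: `y ↦ ỹ`, `d ↦ d_j`, `l ↦ l_j`, `xbar ↦ x̄_j`, `fp ↦ f*_p`.
NOT COVERED: verifying PBQ; certifying `d_j`, `l_j`. -/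
theorem theorem_3 (C : ∀ j, Matrix (σ j) (σ j) ℝ) (A : μ → ∀ j, Matrix (σ j) (σ j) ℝ) (b : μ → ℝ)
    (y : μ → ℝ) (d : ι → ℝ) (l : ι → ℕ) (hD : ∀ j, (C j - ∑ i, y i • A i j).IsHermitian)
    (hd : ∀ j i, d j ≤ (hD j).eigenvalues i)
    (hl : ∀ j, (univ.filter fun i => (hD j).eigenvalues i < 0).card ≤ l j)
    (xbar : ι → ℝ) (hxbar : ∀ j, 0 ≤ xbar j) (fp : ℝ)
    (hPBQ : ∀ ε > 0, ∃ X : ∀ j, Matrix (σ j) (σ j) ℝ, (∀ j, (X j).PosSemidef) ∧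
      (∀ j, (xbar j • (1 : Matrix (σ j) (σ j) ℝ) - X j).PosSemidef) ∧
      (∀ i, ∑ j, trace (A i j * X j) = b i) ∧ ∑ j, trace (C j * X j) - fp ≤ ε) :
    ∑ i, b i * y i + ∑ j, (l j : ℝ) * min 0 (d j) * xbar j ≤ fp := by
  refine le_of_forall_pos_le_add fun ε hε => ?_
  obtain ⟨X, hX, hXub, hAX, hgap⟩ := hPBQ ε hε
  have h := theorem_3_feasible C A b y d l hD hd hl xbar hxbar hX hXub hAX
  linarith

end Theorem3

end Literature.Computation.Certificates.Jansson2006
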